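import Literature.Barriers.ValiantsHypothesis.GCTOccurrenceObstructions
import Literature.Computability.Complexity.OccurrenceObstructionsModuleForm
import HarnessLib

/-!
# Barrier catalogue `ValiantsHypothesis`, GCT occurrence obstructions: the barrier discharged and
# the technique classes refuted, unconditionally (proofs)

Sibling proof file of `GCTOccurrenceObstructions.lean` (D-0014); theorems only, no definitions, no
statement of the parent file is changed.

The parent file records Bürgisser–Ikenmeyer–Panova's "no occurrence obstructions" theorem in MODULE
form as the barrier fact `GCTOccurrenceObstructions` (by definition the tree fact
`Literature.Computability.Complexity.bip2019_not_hasOccurrenceObstruction`: for `1 ≤ n`, `1 ≤ d`,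
`n ^ 25 ≤ m` there is no occurrence obstruction — an irreducible subrepresentation of
`ℂ[Δ[X₀₀^{m-n} per_n]]_d` without nonzero intertwiner to `ℂ[Δ[det_m]]_d` — BIP's padding
`bipPaddedPerPoly`), and the technique classes in the quantifier shape of BIP's Conj. 1.3 — Conj. 1.3
itself (module form), the whole-polynomial-range route shape and the quasi-polynomial-range route
shape of the `GCTMult` crux; it PROVES their refutations from the fact
(`GCTOccurrenceObstructions.not_occurrenceObstructionConjecture`, `.not_occurrenceObstructionRoute`,
`.not_occurrenceObstructionRouteQP`).

The tree proves the fact: `Literature.Computability.Complexity.bip2019_not_hasOccurrenceObstruction_holds`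
(`OccurrenceObstructionsModuleForm.lean`: the weight form `bip2019_no_occurrence_obstructions_holds`
— BIP §6 "Proof of Theorem 1.4" on the proved Thm. 2.1, Lemma 2.2, Props. 2.3, 2.4, Thm. 2.5,
Prop. 3.2, Thm. 4.9, Props. 5.6(2), 5.8(2), 6.1, Thm. 6.2, Prop. 6.3 and the BLMW lift — carried to
the module form by the rationality of the coordinate rings, the existence of highest-weight vectors,
degree pinning, and the extension of highest-weight vectors to intertwiners). Hence, here:

* `GCTOccurrenceObstructions_holds : GCTOccurrenceObstructions` — the barrier, unconditionally;
* `not_occurrenceObstructionConjecture_holds` — BIP Thm. 1.4, "In particular, Conjecture 1.3 is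
  false", unconditionally: the Mulmuley–Sohoni occurrence-obstruction conjecture (BIP Conj. 1.3,
  module form, BIP's padding), SPELLED OUT as the negand (it is a refuted conjecture — a technique
  class, not a fact of the literature; its former name `OccurrenceObstructionConjecture` in the
  parent file is retired in the named-fact verdict clean-up of 2026-08-15 and is not used here);
* `not_occurrenceObstructionRoute_holds`, `not_occurrenceObstructionRouteQP_holds` — the two
  route shapes (formerly the parent file's closed statements `OccurrenceObstructionRoute`,
  `OccurrenceObstructionRouteQP`, likewise retired and spelled out here) are dead as well;
* `not_exists_obstruction_holds`, `not_exists_obstruction_pow_holds` — the predicate forms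
  without the hypothesis `h : GCTOccurrenceObstructions`.

Trust base of all six: the axiom whitelist only. Letters as in the parent file (`n` permanent size,
`m` determinant size, over `ℂ`).

## References

* P. Bürgisser, C. Ikenmeyer, G. Panova, *No occurrence obstructions in geometric complexity
  theory*, J. AMS 32 (2019) 163–193 = arXiv:1604.06431v3, §1.1 (Conj. 1.1–1.3), Thm. 1.4; held text
  arXiv:1604.06431 (v1 flat numbering) p. 4: Conjecture 3 (= Conj. 1.3) "For all `c ∈ ℕ_{≥1}`, for
  infinitely many `m`, there exists a partition `λ` occurring in `ℂ[Z_{m^c,m}]` but not in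
  `ℂ[Ω_{m^c}]`" — "Unfortunately, this conjecture is false! This is the main result of this work."
  — Theorem 4 (= Thm. 1.4) "Let `n,d,m` be positive integers with `n ≥ m^{25}` and `λ ⊢ nd`. If `λ`
  occurs in `ℂ[Z_{n,m}]`, then `λ` also occurs in `ℂ[Ω_n]`. In particular, Conjecture (conj:occ-obstr)
  is false." [BurgisserIkenmeyerPanovaJAMS2019]

## Tree

`Literature.Computability.Complexity.bip2019_not_hasOccurrenceObstruction_holds`
(`OccurrenceObstructionsModuleForm.lean`); the parent file's conditional theorems
`GCTOccurrenceObstructions.not_exists_obstruction`, `.not_exists_obstruction_pow`,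
`.not_occurrenceObstructionConjecture`, `.not_occurrenceObstructionRoute`,
`.not_occurrenceObstructionRouteQP`. The weight-form twin for the summit `PneNP` is
`Literature/Barriers/PneNP/GCTOccurrenceObstructionsProofs.lean`.
-/

noncomputable section

namespace Literature.Barriers.ValiantsHypothesis

open Literature.Computability.AlgebraicComplexity Literature.Computability.Complexity

/-- **The barrier holds, unconditionally (Bürgisser–Ikenmeyer–Panova, J. AMS 32 (2019), Thm. 1.4,
module form): discharge of `GCTOccurrenceObstructions`.** The barrier fact is definitionally the
tree fact `Literature.Computability.Complexity.bip2019_not_hasOccurrenceObstruction` (for `1 ≤ n`,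
`1 ≤ d`, `n ^ 25 ≤ m`, no occurrence obstruction against `X₀₀^{m-n} per_n ∈ Δ[det_m]` in degree
`d`, BIP's padding), which the tree proves as
`Literature.Computability.Complexity.bip2019_not_hasOccurrenceObstruction_holds`
(`OccurrenceObstructionsModuleForm.lean`: weight form of Thm. 1.4, BIP §6, plus the
weight-to-module bridge). [cite: BurgisserIkenmeyerPanovaJAMS2019, Thm. 1.4] -/
theorem GCTOccurrenceObstructions_holds :
    Literature.Barriers.ValiantsHypothesis.GCTOccurrenceObstructions :=
  bip2019_not_hasOccurrenceObstruction_holds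

/-- **BIP Thm. 1.4, "In particular, Conjecture 1.3 is false" — unconditionally, module form.**
The negand is the Mulmuley–Sohoni occurrence-obstruction conjecture, BIP Conj. 1.3 — "For all
`c ∈ ℕ_{≥1}`, for infinitely many `m`, there exists a partition `λ` occurring in `ℂ[Z_{m^c,m}]` but
not in `ℂ[Ω_{m^c}]`" — spelled out in the tree's letters (permanent size `n`, determinant size
`n ^ c`; "infinitely many" as `∀ n₀, ∃ n ≥ n₀` with `1 ≤ n`; occurrence-but-not-occurrence in the
module form `HasOccurrenceObstruction (det_{n^c}) (X₀₀^{n^c-n} per_n) (n^c) d` in some positive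
degree `d`; BIP's padding `bipPaddedPerPoly`; the `NeZero (n ^ c)` instance as a binder). It is
FALSE: the parent file's `GCTOccurrenceObstructions.not_occurrenceObstructionConjecture` fed with
`GCTOccurrenceObstructions_holds` (at `c = 25`, every `n ≥ 1` carries no obstruction in any
positive degree). The source: "Unfortunately, this conjecture is false! This is the main result of
this work." A refuted conjecture is a technique class, not a fact of the literature: the negand's
former name `OccurrenceObstructionConjecture` (parent file) is retired and deliberately not used.
[cite: BurgisserIkenmeyerPanovaJAMS2019, Conj. 1.3 (§1.1) and Thm. 1.4 ("In particular, Conjecture 1.3 is false")] -/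
theorem not_occurrenceObstructionConjecture_holds :
    ¬ (∀ c : ℕ, 1 ≤ c → ∀ n₀ : ℕ, ∃ n : ℕ, n₀ ≤ n ∧ 1 ≤ n ∧
      ∀ [NeZero (n ^ c)], ∃ d : ℕ, 1 ≤ d ∧
        HasOccurrenceObstruction (detPoly (Fin (n ^ c)) ℂ) (bipPaddedPerPoly ℂ n (n ^ c)) (n ^ c) d) :=
  GCTOccurrenceObstructions_holds.not_occurrenceObstructionConjecture

/-- **The whole-range occurrence route is dead, unconditionally**: there is no family of occurrence
obstructions against `X₀₀^{m-n} per_n ∈ Δ[det_m]` at all determinant sizes `n ≤ m ≤ n ^ c`, all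
large `n`, for every `c` (spelled out; formerly the parent file's closed statement
`OccurrenceObstructionRoute`, retired; it implies Conj. 1.3 and fails at `c = 25`).
[cite: BurgisserIkenmeyerPanovaJAMS2019, Thm. 1.4] -/
theorem not_occurrenceObstructionRoute_holds :
    ¬ (∀ c : ℕ, ∃ n₀ : ℕ, ∀ n ≥ n₀, ∀ (m : ℕ) [NeZero m], n ≤ m → m ≤ n ^ c →
      ∃ d : ℕ, 1 ≤ d ∧ HasOccurrenceObstruction (detPoly (Fin m) ℂ) (bipPaddedPerPoly ℂ n m) m d) :=
  GCTOccurrenceObstructions_holds.not_occurrenceObstructionRoute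

/-- **The quasi-polynomial occurrence route is dead, unconditionally**: the occurrence analogue of
the `GCTMult` crux of this summit (occurrence obstructions at every `n ≤ m ≤ 2^{(log₂ n + c)^c}`,
all large `n`, every `c`; spelled out; formerly the parent file's closed statement
`OccurrenceObstructionRouteQP`, retired) fails, since at `c = 25` the range contains `m = n^25`.
[cite: BurgisserIkenmeyerPanovaJAMS2019, Thm. 1.4] -/
theorem not_occurrenceObstructionRouteQP_holds :
    ¬ (∀ c : ℕ, ∃ n₀ : ℕ, ∀ n ≥ n₀, ∀ (m : ℕ) [NeZero m], n ≤ m → m ≤ 2 ^ ((Nat.log 2 n + c) ^ c) →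
      ∃ d : ℕ, 1 ≤ d ∧ HasOccurrenceObstruction (detPoly (Fin m) ℂ) (bipPaddedPerPoly ℂ n m) m d) :=
  GCTOccurrenceObstructions_holds.not_occurrenceObstructionRouteQP

/-- **No occurrence obstruction in any positive degree at `(n, m)` once `n ^ 25 ≤ m`, `1 ≤ n`
(BIP's padding), unconditionally** — the predicate form of Thm. 1.4 in module rendering, without the
hypothesis `h : GCTOccurrenceObstructions`. [cite: BurgisserIkenmeyerPanovaJAMS2019, Thm. 1.4] -/
theorem not_exists_obstruction_holds {n m : ℕ} [NeZero m] (hn : 1 ≤ n) (hnm : n ^ 25 ≤ m) :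
    ¬ ∃ d : ℕ, 1 ≤ d ∧
      HasOccurrenceObstruction (detPoly (Fin m) ℂ) (bipPaddedPerPoly ℂ n m) m d :=
  GCTOccurrenceObstructions_holds.not_exists_obstruction hn hnm

/-- The same in the polynomial regime of Conj. 1.2/1.3: for every exponent `c ≥ 25` and every
`n ≥ 1` there is no occurrence obstruction against `X₀₀^{n^c - n} per_n ∈ Δ[det_{n^c}]` in any
positive degree, unconditionally. [cite: BurgisserIkenmeyerPanovaJAMS2019, Thm. 1.4] -/
theorem not_exists_obstruction_pow_holds {c n : ℕ} (hc : 25 ≤ c) (hn : 1 ≤ n) [NeZero (n ^ c)] :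
    ¬ ∃ d : ℕ, 1 ≤ d ∧
      HasOccurrenceObstruction (detPoly (Fin (n ^ c)) ℂ) (bipPaddedPerPoly ℂ n (n ^ c)) (n ^ c) d :=
  GCTOccurrenceObstructions_holds.not_exists_obstruction_pow hc hn

end Literature.Barriers.ValiantsHypothesis

end
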